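import Mathlib.Data.Set.Card
import Literature.MathematicalPhysics.StatisticalMechanics.BarlowCoordination
import Literature.MathematicalPhysics.StatisticalMechanics.BarlowRings
import Literature.Probability.Process.RootedHardCoreConfig

/-!
# `StackingHinge` (stmt-AtomisticToContinuum-14993), line `Sketch`: stub `stub_localBarlowStructure`

EXACT LOCAL COMBINATORICS of a `δ`-separated set `S ⊆ ℝ³` all of whose points `x` are
SLP-good (with `nn := infDist x (S ∖ {x})`: for every precision `t > nn/6` and radius `r < 3 nn`
the set `S ∩ B̄(x, r)` is two-way `t`-matched with a rigidly moved ideal Barlow stacking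
`g '' barlowStacking nn (nn√(2/3)) s`, `s` a Hägg word) and bond-shell-good (twelve points of
`S ∖ {x}` within `1.01 nn`), GIVEN single occupancy of the deep pattern points (the conclusion of
the neighbouring stub `stub_singleOccupancy`, taken here as the first hypothesis).  At every
`x ∈ S`:

* (a) every `y ∈ S` within `2 nn` has scale `≥ 13 nn / 20`;
* (b) bonds `dist x y ≤ 1.01 nn` are symmetric (`dist x y ≤ 1.01 nn_y`);
* (c) the set of bonded neighbours of `x` has `ncard` exactly `12`;
* (d) two bonded neighbours of `x` are bonded to each other iff their pattern labels (for any
  admissible matching data at `x`) are at distance exactly `nn`.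

Proof (lead's plan).  Fix admissible matching data `(t, r, s, g)` at `x` (`nn/6 < t ≤ 7nn/40`,
`r ≥ 29nn/10`) and label every `p ∈ S` with `dist x p ≤ r` by a pattern point `lab p` with
`dist p (g (lab p)) ≤ t`.  Single occupancy makes `lab` injective on deep points, and distinct
pattern points are `≥ nn` apart (`le_dist_of_mem_barlowStacking_ideal`), whence (a)
(`scale_lower`); labels of distinct points at mutual distance `≤ 1.03 nn` are `< √2 nn` apart,
hence touch (`eq_or_dist_eq_of_dist_lt`; `labels_touch`); the twelve bond-shell neighbours of a
bonded `y` are labelled injectively inside the twelve-point touching set of the label of `y`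
(`ncard_touching_eq_twelve`), hence ONTO it (`touching_subset_labels`), which gives (b) and (d)
(`dist_le_of_labels_touch`); (c) is the count `12 ≤ #N ≤ 12` (`twelve_le_ncard_bonded`,
`ncard_bonded_le`).  All [folklore] given the cited Barlow facts (in tree, `BarlowCoordination`,
`BarlowRings`).
-/

noncomputable section

namespace Summit.AtomisticToContinuum.Crystallization.Theorems.PricedHcpWindowsLocalBarlowStructure

open Literature.MathematicalPhysics.StatisticalMechanics

variable {S : Set (EuclideanSpace ℝ (Fin 3))} {x : EuclideanSpace ℝ (Fin 3)} {a t r : ℝ} {s : ℤ → ℤ}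
  {g : EuclideanSpace ℝ (Fin 3) ≃ᵃⁱ[ℝ] EuclideanSpace ℝ (Fin 3)}

/-! ## Pattern facts at the ideal layer spacing -/

/-- `1.38 a < √2 a` for `a > 0`. [folklore] -/
theorem lt_sqrt_two_mul (ha : 0 < a) : 138 / 100 * a < Real.sqrt 2 * a := by
  refine mul_lt_mul_of_pos_right ?_ ha
  rw [Real.lt_sqrt (by norm_num)]; norm_num

/-- Triangle inequality through the rigid motion: two labels are no further apart than the two
points plus the two matching errors. [folklore] -/
theorem dist_labels_le (g : EuclideanSpace ℝ (Fin 3) ≃ᵃⁱ[ℝ] EuclideanSpace ℝ (Fin 3))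
    (y y' z z' : EuclideanSpace ℝ (Fin 3)) :
    dist z z' ≤ dist y (g z) + dist y y' + dist y' (g z') := by
  rw [← g.dist_map z z', dist_comm y (g z)]
  exact dist_triangle4 (g z) y y' (g z')

/-- **Labels of close points touch**: two distinct pattern points matched within `t ≤ 7a/40` to
points at mutual distance `≤ 1.03 a` are at distance exactly `a` (the distance gap `(a, √2 a)` of
the ideal stacking, `eq_or_dist_eq_of_dist_lt`). [folklore] -/
theorem labels_touch (hs : IsHaggSeq s) (ha : 0 < a) (ht : t ≤ 7 / 40 * a)
    {y y' z z' : EuclideanSpace ℝ (Fin 3)}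
    (hz : z ∈ barlowStacking a (a * Real.sqrt (2 / 3)) s)
    (hz' : z' ∈ barlowStacking a (a * Real.sqrt (2 / 3)) s) (hne : z ≠ z')
    (hyz : dist y (g z) ≤ t) (hy'z' : dist y' (g z') ≤ t) (hd : dist y y' ≤ 103 / 100 * a) :
    dist z z' = a := by
  have hh : (a * Real.sqrt (2 / 3)) ^ 2 = 2 / 3 * a ^ 2 := by
    rw [mul_pow, Real.sq_sqrt (by norm_num : (0 : ℝ) ≤ 2 / 3)]; ring
  refine (eq_or_dist_eq_of_dist_lt hs ha hh hz hz' ?_).resolve_left hne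
  have := dist_labels_le g y y' z z'
  linarith [lt_sqrt_two_mul ha]

/-! ## Consequences of single occupancy for one matching datum at `x` -/

/-- **The bond shell is labelled onto the touching set.**  For admissible matching data at `x`
with single occupancy of the deep pattern points, let `y ∈ S` be bonded to `x`
(`dist x y ≤ 1.01 a`) with label `z`, scale `m ≤ 1.01 a`, and twelve points `T` of `S ∖ {y}`
within `1.01 m` of `y`.  Then every pattern point touching `z` carries (within `t`) a point of
`T`: the labels of `T` are twelve distinct points of the twelve-point touching set of `z`.
[folklore] -/
theorem touching_subset_labels (hs : IsHaggSeq s) (ha : 0 < a) (ht : t ≤ 7 / 40 * a)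
    (hr : 29 / 10 * a ≤ r)
    (hCL1 : ∀ y ∈ S, dist x y ≤ r → ∃ z ∈ barlowStacking a (a * Real.sqrt (2 / 3)) s,
      dist y (g z) ≤ t)
    (hSO : ∀ z ∈ barlowStacking a (a * Real.sqrt (2 / 3)) s, dist x (g z) ≤ 9 / 4 * a →
      ∀ y ∈ S, ∀ y' ∈ S, dist y (g z) ≤ t → dist y' (g z) ≤ t → y = y')
    {y z : EuclideanSpace ℝ (Fin 3)} {m : ℝ} {T : Finset (EuclideanSpace ℝ (Fin 3))} (hy : y ∈ S)
    (hxy : dist x y ≤ 101 / 100 * a)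
    (hz : z ∈ barlowStacking a (a * Real.sqrt (2 / 3)) s) (hyz : dist y (g z) ≤ t)
    (hm : m ≤ 101 / 100 * a)
    (hT : (↑T : Set (EuclideanSpace ℝ (Fin 3))) ⊆
      {p : EuclideanSpace ℝ (Fin 3) | p ∈ S ∧ p ≠ y ∧ dist y p ≤ 101 / 100 * m})
    (hTc : T.card = 12) :
    ∀ w ∈ barlowStacking a (a * Real.sqrt (2 / 3)) s, dist z w = a →
      ∃ p ∈ T, dist p (g w) ≤ t := by
  choose! lab hlabB hlabt using hCL1
  have hh : (a * Real.sqrt (2 / 3)) ^ 2 = 2 / 3 * a ^ 2 := by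
    rw [mul_pow, Real.sq_sqrt (by norm_num : (0 : ℝ) ≤ 2 / 3)]; ring
  have ht0 : 0 ≤ t := dist_nonneg.trans hyz
  have hTS : ∀ p ∈ T, p ∈ S ∧ p ≠ y ∧ dist y p ≤ 101 / 100 * m :=
    fun p hp => hT (Finset.mem_coe.2 hp)
  have hyp : ∀ p ∈ T, dist y p ≤ 103 / 100 * a := fun p hp => by
    have := (hTS p hp).2.2; nlinarith
  have hxp : ∀ p ∈ T, dist x p ≤ r := fun p hp => by
    have := dist_triangle x y p; have := hyp p hp; linarith
  have hzdeep : dist x (g z) ≤ 9 / 4 * a := by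
    have := dist_triangle x y (g z); linarith
  have hdeep : ∀ p ∈ T, dist x (g (lab p)) ≤ 9 / 4 * a := fun p hp => by
    have h1 := dist_triangle x p (g (lab p))
    have h2 := hlabt p (hTS p hp).1 (hxp p hp)
    have := hyp p hp; have := dist_triangle x y p
    linarith
  -- the labels of the shell points touch `z`
  have htouch : ∀ p ∈ T, dist z (lab p) = a := fun p hp => by
    obtain ⟨hpS, hpy, -⟩ := hTS p hp
    have hlabp := hlabt p hpS (hxp p hp)
    refine labels_touch hs ha ht hz (hlabB p hpS (hxp p hp)) ?_ hyz hlabp (hyp p hp)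
    intro heq
    rw [← heq] at hlabp
    exact hpy (hSO z hz hzdeep p hpS y hy hlabp hyz)
  -- the labelling is injective on the shell
  have hinj : Set.InjOn lab ↑T := by
    intro p hp p' hp' heq
    have hpS := (hTS p (Finset.mem_coe.1 hp)).1
    have hp'S := (hTS p' (Finset.mem_coe.1 hp')).1
    have h1 := hlabt p hpS (hxp p hp)
    have h2 := hlabt p' hp'S (hxp p' hp')
    rw [← heq] at h2
    exact hSO _ (hlabB p hpS (hxp p hp)) (hdeep p hp) p hpS p' hp'S h1 h2
  -- twelve distinct labels inside the twelve-point touching set: the image is all of it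
  have hfin : {w | w ∈ barlowStacking a (a * Real.sqrt (2 / 3)) s ∧ dist z w = a}.Finite :=
    Set.finite_of_ncard_pos (by rw [ncard_touching_eq_twelve hs ha hh hz]; norm_num)
  have hsub : lab '' ↑T ⊆ {w | w ∈ barlowStacking a (a * Real.sqrt (2 / 3)) s ∧ dist z w = a} := by
    rintro _ ⟨p, hp, rfl⟩
    exact ⟨hlabB p (hTS p hp).1 (hxp p hp), htouch p hp⟩
  have heq : lab '' ↑T = {w | w ∈ barlowStacking a (a * Real.sqrt (2 / 3)) s ∧ dist z w = a} :=
    Set.eq_of_subset_of_ncard_le hsub (by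
      rw [ncard_touching_eq_twelve hs ha hh hz, hinj.ncard_image, Set.ncard_coe_finset,
        hTc]) hfin
  intro w hw hzw
  have hw' : w ∈ lab '' ↑T := by rw [heq]; exact ⟨hw, hzw⟩
  obtain ⟨p, hp, rfl⟩ := hw'
  exact ⟨p, hp, hlabt p (hTS p hp).1 (hxp p hp)⟩

/-- **Exact links, easy direction**: with the data of `touching_subset_labels`, a point `y' ∈ S`
matched to a deep pattern point `w` touching the label `z` of `y` is a bond-shell neighbour of `y`:
`dist y y' ≤ 1.01 m`. [folklore] -/
theorem dist_le_of_labels_touch (hs : IsHaggSeq s) (ha : 0 < a) (ht : t ≤ 7 / 40 * a)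
    (hr : 29 / 10 * a ≤ r)
    (hCL1 : ∀ y ∈ S, dist x y ≤ r → ∃ z ∈ barlowStacking a (a * Real.sqrt (2 / 3)) s,
      dist y (g z) ≤ t)
    (hSO : ∀ z ∈ barlowStacking a (a * Real.sqrt (2 / 3)) s, dist x (g z) ≤ 9 / 4 * a →
      ∀ y ∈ S, ∀ y' ∈ S, dist y (g z) ≤ t → dist y' (g z) ≤ t → y = y')
    {y z : EuclideanSpace ℝ (Fin 3)} {m : ℝ} {T : Finset (EuclideanSpace ℝ (Fin 3))} (hy : y ∈ S)
    (hxy : dist x y ≤ 101 / 100 * a)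
    (hz : z ∈ barlowStacking a (a * Real.sqrt (2 / 3)) s) (hyz : dist y (g z) ≤ t)
    (hm : m ≤ 101 / 100 * a)
    (hT : (↑T : Set (EuclideanSpace ℝ (Fin 3))) ⊆
      {p : EuclideanSpace ℝ (Fin 3) | p ∈ S ∧ p ≠ y ∧ dist y p ≤ 101 / 100 * m})
    (hTc : T.card = 12) {y' w : EuclideanSpace ℝ (Fin 3)} (hy' : y' ∈ S)
    (hw : w ∈ barlowStacking a (a * Real.sqrt (2 / 3)) s) (hzw : dist z w = a)
    (hwdeep : dist x (g w) ≤ 9 / 4 * a) (hy'w : dist y' (g w) ≤ t) :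
    dist y y' ≤ 101 / 100 * m := by
  obtain ⟨p, hp, hpw⟩ :=
    touching_subset_labels hs ha ht hr hCL1 hSO hy hxy hz hyz hm hT hTc w hw hzw
  obtain ⟨hpS, -, hyp⟩ := hT (Finset.mem_coe.2 hp)
  rw [← hSO w hw hwdeep p hpS y' hy' hpw hy'w]
  exact hyp

/-- **At most twelve bonded neighbours**: the labels of the points of `S ∖ {x}` within `1.01 a`
of `x` are distinct (single occupancy) points of the touching set of the label of `x`.
[folklore] -/
theorem ncard_bonded_le (hs : IsHaggSeq s) (ha : 0 < a) (ht : t ≤ 7 / 40 * a)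
    (hr : 29 / 10 * a ≤ r)
    (hCL1 : ∀ y ∈ S, dist x y ≤ r → ∃ z ∈ barlowStacking a (a * Real.sqrt (2 / 3)) s,
      dist y (g z) ≤ t)
    (hSO : ∀ z ∈ barlowStacking a (a * Real.sqrt (2 / 3)) s, dist x (g z) ≤ 9 / 4 * a →
      ∀ y ∈ S, ∀ y' ∈ S, dist y (g z) ≤ t → dist y' (g z) ≤ t → y = y')
    (hx : x ∈ S) :
    {y : EuclideanSpace ℝ (Fin 3) | y ∈ S ∧ y ≠ x ∧ dist x y ≤ 101 / 100 * a}.ncard ≤ 12 := by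
  choose! lab hlabB hlabt using hCL1
  have hh : (a * Real.sqrt (2 / 3)) ^ 2 = 2 / 3 * a ^ 2 := by
    rw [mul_pow, Real.sq_sqrt (by norm_num : (0 : ℝ) ≤ 2 / 3)]; ring
  have hr0 : dist x x ≤ r := by rw [dist_self]; linarith
  have hz₀ := hlabB x hx hr0
  have hxz₀ := hlabt x hx hr0
  have ht0 : 0 ≤ t := dist_nonneg.trans hxz₀
  have hfin : {w | w ∈ barlowStacking a (a * Real.sqrt (2 / 3)) s ∧ dist (lab x) w = a}.Finite :=
    Set.finite_of_ncard_pos (by rw [ncard_touching_eq_twelve hs ha hh hz₀]; norm_num)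
  refine (Set.ncard_le_ncard_of_injOn lab ?_ ?_ hfin).trans_eq
    (ncard_touching_eq_twelve hs ha hh hz₀)
  · rintro y ⟨hy, hyx, hxy⟩
    have hyr : dist x y ≤ r := by linarith
    refine ⟨hlabB y hy hyr,
      labels_touch hs ha ht hz₀ (hlabB y hy hyr) ?_ hxz₀ (hlabt y hy hyr) (by linarith)⟩
    intro heq
    have h2 := hlabt y hy hyr
    rw [← heq] at h2
    exact hyx (hSO _ hz₀ (by linarith) x hx y hy hxz₀ h2).symm
  · rintro y ⟨hy, -, hxy⟩ y' ⟨hy', -, hxy'⟩ heq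
    have hyr : dist x y ≤ r := by linarith
    have hy'r : dist x y' ≤ r := by linarith
    have h1 := hlabt y hy hyr
    have h2 := hlabt y' hy' hy'r
    rw [← heq] at h2
    refine hSO _ (hlabB y hy hyr) ?_ y hy y' hy' h1 h2
    have := dist_triangle x y (g (lab y)); linarith

/-- **Scale comparability**: a point `y ∈ S` within `2a` of `x` has no other point of `S` within
`13a/20`: both points would carry distinct labels (single occupancy at the deep label of `y`),
which are `≥ a` apart in the ideal stacking, while the points are `< a − 2t` apart. [folklore] -/
theorem scale_lower (hs : IsHaggSeq s) (ha : 0 < a) (ht : t ≤ 7 / 40 * a) (hr : 29 / 10 * a ≤ r)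
    (hCL1 : ∀ y ∈ S, dist x y ≤ r → ∃ z ∈ barlowStacking a (a * Real.sqrt (2 / 3)) s,
      dist y (g z) ≤ t)
    (hSO : ∀ z ∈ barlowStacking a (a * Real.sqrt (2 / 3)) s, dist x (g z) ≤ 9 / 4 * a →
      ∀ y ∈ S, ∀ y' ∈ S, dist y (g z) ≤ t → dist y' (g z) ≤ t → y = y')
    {y : EuclideanSpace ℝ (Fin 3)} (hy : y ∈ S) (hxy : dist x y ≤ 2 * a)
    (hne : (S \ {y}).Nonempty) :
    13 / 20 * a ≤ Metric.infDist y (S \ {y}) := by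
  have hh : (a * Real.sqrt (2 / 3)) ^ 2 = 2 / 3 * a ^ 2 := by
    rw [mul_pow, Real.sq_sqrt (by norm_num : (0 : ℝ) ≤ 2 / 3)]; ring
  rw [Metric.le_infDist hne]
  intro y₁ hy₁
  obtain ⟨hy₁S, hy₁y⟩ := hy₁
  by_contra hlt
  push Not at hlt
  obtain ⟨z, hz, hyz⟩ := hCL1 y hy (by linarith)
  have ht0 : 0 ≤ t := dist_nonneg.trans hyz
  obtain ⟨z₁, hz₁, hy₁z₁⟩ := hCL1 y₁ hy₁S (by have := dist_triangle x y y₁; linarith)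
  have hne : z ≠ z₁ := by
    intro heq
    rw [← heq] at hy₁z₁
    refine hy₁y (hSO z hz ?_ y₁ hy₁S y hy hy₁z₁ hyz)
    have := dist_triangle x y (g z); linarith
  have h1 := le_dist_of_mem_barlowStacking_ideal hs ha hh hz hz₁ hne
  have h2 := dist_labels_le g y y₁ z z₁
  linarith

/-- **At least twelve bonded neighbours**: the twelve-point Finset of bond-shell-goodness sits in
the (finite, by `δ`-separation) set of bonded neighbours. [folklore] -/
theorem twelve_le_ncard_bonded {δ : ℝ} (hδ : 0 < δ)
    (hsep : ∀ x ∈ S, ∀ y ∈ S, x ≠ y → δ ≤ dist x y) (x : EuclideanSpace ℝ (Fin 3)) (c : ℝ)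
    {T : Finset (EuclideanSpace ℝ (Fin 3))}
    (hT : (↑T : Set (EuclideanSpace ℝ (Fin 3))) ⊆
      {y : EuclideanSpace ℝ (Fin 3) | y ∈ S ∧ y ≠ x ∧ dist x y ≤ c}) (hTc : T.card = 12) :
    12 ≤ {y : EuclideanSpace ℝ (Fin 3) | y ∈ S ∧ y ≠ x ∧ dist x y ≤ c}.ncard := by
  have hfin : {y : EuclideanSpace ℝ (Fin 3) | y ∈ S ∧ y ≠ x ∧ dist x y ≤ c}.Finite := by
    refine (Literature.Probability.Process.LocalConfig.finite_inter_of_separated hδ hsep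
      (isCompact_closedBall x c)).subset ?_
    rintro y ⟨hy, -, hxy⟩
    exact ⟨Metric.mem_closedBall'.2 hxy, hy⟩
  calc 12 = (↑T : Set (EuclideanSpace ℝ (Fin 3))).ncard := by rw [Set.ncard_coe_finset, hTc]
    _ ≤ _ := Set.ncard_le_ncard hT hfin

/-! ## The stub -/

/-- **stub_localBarlowStructure** (EXACT LOCAL COMBINATORICS).  In a `δ`-separated set all of
whose points are SLP-good and bond-shell-good, given single occupancy of the deep pattern points
(first hypothesis: the conclusion of `stub_singleOccupancy`), at every `x ∈ S` with
`nn := infDist x (S ∖ {x})`: (a) every `y ∈ S` within `2 nn` has scale `≥ 13 nn / 20`;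
(b) bonds `dist x y ≤ 1.01 nn` are symmetric; (c) exactly twelve bonded neighbours;
(d) two bonded neighbours `y ≠ y'` of `x` are bonded iff their labels are at distance `nn`.
[folklore] -/
theorem stub_localBarlowStructure : (∀ δ : ℝ, 0 < δ → ∀ S : Set (EuclideanSpace ℝ (Fin 3)), (∀ x ∈ S, ∀ y ∈ S, x ≠ y → δ ≤ dist x y) → (∀ x ∈ S, (∀ t r : ℝ, Metric.infDist x (S \ {x}) / 6 < t → r < 3 * Metric.infDist x (S \ {x}) → ∃ s : ℤ → ℤ, Literature.MathematicalPhysics.StatisticalMechanics.IsHaggSeq s ∧ ∃ g : EuclideanSpace ℝ (Fin 3) ≃ᵃⁱ[ℝ] EuclideanSpace ℝ (Fin 3), (∀ y ∈ S, dist x y ≤ r → ∃ z ∈ Literature.MathematicalPhysics.StatisticalMechanics.barlowStacking (Metric.infDist x (S \ {x})) (Metric.infDist x (S \ {x}) * Real.sqrt (2 / 3)) s, dist y (g z) ≤ t) ∧ (∀ z ∈ Literature.MathematicalPhysics.StatisticalMechanics.barlowStacking (Metric.infDist x (S \ {x})) (Metric.infDist x (S \ {x}) * Real.sqrt (2 /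 3)) s, dist x (g z) ≤ r → ∃ y ∈ S, dist y (g z) ≤ t)) ∧ ((∀ y ∈ S, y ≠ x → dist x y < 107 / 100 * Metric.infDist x (S \ {x}) → dist x y ≤ 101 / 100 * Metric.infDist x (S \ {x})) ∧ ∃ T : Finset (EuclideanSpace ℝ (Fin 3)), (↑T : Set (EuclideanSpace ℝ (Fin 3))) ⊆ {y : EuclideanSpace ℝ (Fin 3) | y ∈ S ∧ y ≠ x ∧ dist x y ≤ 101 / 100 * Metric.infDist x (S \ {x})} ∧ T.card = 12)) → ∀ x ∈ S, ∀ t r : ℝ, Metric.infDist x (S \ {x}) / 6 < t → t ≤ 7 / 40 * Metric.infDist x (S \ {x}) → 29 / 10 * Metric.infDist x (S \ {x}) ≤ r → ∀ (s : ℤ → ℤ) (g : EuclideanSpace ℝ (Fin 3) ≃ᵃⁱ[ℝ] EuclideanSpace ℝ (Fin 3)), Literature.MathematicalPhysics.StatisticalMechanics.IsHaggSeq s → (∀ y ∈ S, dist x y ≤ r → ∃ z ∈ Literature.MathematicalPhysics.StatisticalMechanics.barlowStacking (Metric.infDist x (S \ {x})) (Metric.infDist x (S \ {x}) * Real.sqrt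 (2 / 3)) s, dist y (g z) ≤ t) → (∀ z ∈ Literature.MathematicalPhysics.StatisticalMechanics.barlowStacking (Metric.infDist x (S \ {x})) (Metric.infDist x (S \ {x}) * Real.sqrt (2 / 3)) s, dist x (g z) ≤ r → ∃ y ∈ S, dist y (g z) ≤ t) → ∀ z ∈ Literature.MathematicalPhysics.StatisticalMechanics.barlowStacking (Metric.infDist x (S \ {x})) (Metric.infDist x (S \ {x}) * Real.sqrt (2 / 3)) s, dist x (g z) ≤ 9 / 4 * Metric.infDist x (S \ {x}) → ∀ y ∈ S, ∀ y' ∈ S, dist y (g z) ≤ t → dist y' (g z) ≤ t → y = y') → ∀ δ : ℝ, 0 < δ → ∀ S : Set (EuclideanSpace ℝ (Fin 3)), (∀ x ∈ S, ∀ y ∈ S, x ≠ y → δ ≤ dist x y) → (∀ x ∈ S, (∀ t r : ℝ, Metric.infDist x (S \ {x}) / 6 < t → r < 3 * Metric.infDist x (S \ {x}) → ∃ s : ℤ → ℤ, Literature.MathematicalPhysics.StatisticalMechanics.IsHaggSeq s ∧ ∃ g : EuclideanSpace ℝ (Fin 3) ≃ᵃⁱ[ℝ] EuclideanSpace ℝ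 (Fin 3), (∀ y ∈ S, dist x y ≤ r → ∃ z ∈ Literature.MathematicalPhysics.StatisticalMechanics.barlowStacking (Metric.infDist x (S \ {x})) (Metric.infDist x (S \ {x}) * Real.sqrt (2 / 3)) s, dist y (g z) ≤ t) ∧ (∀ z ∈ Literature.MathematicalPhysics.StatisticalMechanics.barlowStacking (Metric.infDist x (S \ {x})) (Metric.infDist x (S \ {x}) * Real.sqrt (2 / 3)) s, dist x (g z) ≤ r → ∃ y ∈ S, dist y (g z) ≤ t)) ∧ ((∀ y ∈ S, y ≠ x → dist x y < 107 / 100 * Metric.infDist x (S \ {x}) → dist x y ≤ 101 / 100 * Metric.infDist x (S \ {x})) ∧ ∃ T : Finset (EuclideanSpace ℝ (Fin 3)), (↑T : Set (EuclideanSpace ℝ (Fin 3))) ⊆ {y : EuclideanSpace ℝ (Fin 3) | y ∈ S ∧ y ≠ x ∧ dist x y ≤ 101 / 100 * Metric.infDist x (S \ {x})} ∧ T.card = 12)) → ∀ x ∈ S, ((∀ y ∈ S, dist x y ≤ 2 * Metric.infDist x (S \ {x}) → 13 / 20 * Metric.infDist x (S \ {x}) ≤ Metric.infDist y (S \ {y}))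 ∧ (∀ y ∈ S, y ≠ x → dist x y ≤ 101 / 100 * Metric.infDist x (S \ {x}) → dist x y ≤ 101 / 100 * Metric.infDist y (S \ {y})) ∧ ({y : EuclideanSpace ℝ (Fin 3) | y ∈ S ∧ y ≠ x ∧ dist x y ≤ 101 / 100 * Metric.infDist x (S \ {x})}.ncard = 12) ∧ (∀ t r : ℝ, Metric.infDist x (S \ {x}) / 6 < t → t ≤ 7 / 40 * Metric.infDist x (S \ {x}) → 29 / 10 * Metric.infDist x (S \ {x}) ≤ r → ∀ (s : ℤ → ℤ) (g : EuclideanSpace ℝ (Fin 3) ≃ᵃⁱ[ℝ] EuclideanSpace ℝ (Fin 3)), Literature.MathematicalPhysics.StatisticalMechanics.IsHaggSeq s → (∀ y ∈ S, dist x y ≤ r → ∃ z ∈ Literature.MathematicalPhysics.StatisticalMechanics.barlowStacking (Metric.infDist x (S \ {x})) (Metric.infDist x (S \ {x}) * Real.sqrt (2 / 3)) s, dist y (g z) ≤ t) → (∀ z ∈ Literature.MathematicalPhysics.StatisticalMechanics.barlowStacking (Metric.infDist x (S \ {x})) (Metric.infDist x (S \ {x}) * Real.sqrt (2 / 3)) s,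 dist x (g z) ≤ r → ∃ y ∈ S, dist y (g z) ≤ t) → ∀ y ∈ S, ∀ y' ∈ S, y ≠ x → dist x y ≤ 101 / 100 * Metric.infDist x (S \ {x}) → y' ≠ x → dist x y' ≤ 101 / 100 * Metric.infDist x (S \ {x}) → y ≠ y' → ∀ z ∈ Literature.MathematicalPhysics.StatisticalMechanics.barlowStacking (Metric.infDist x (S \ {x})) (Metric.infDist x (S \ {x}) * Real.sqrt (2 / 3)) s, ∀ z' ∈ Literature.MathematicalPhysics.StatisticalMechanics.barlowStacking (Metric.infDist x (S \ {x})) (Metric.infDist x (S \ {x}) * Real.sqrt (2 / 3)) s, dist y (g z) ≤ t → dist y' (g z') ≤ t → (dist y y' ≤ 101 / 100 * Metric.infDist y (S \ {y}) ↔ dist z z' = Metric.infDist x (S \ {x})))) := by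
  intro hL1 δ hδ S hsep hgood x hx
  have hL1S := hL1 δ hδ S hsep hgood
  obtain ⟨hslp, -, T, hT, hTc⟩ := hgood x hx
  -- `S ∖ {x}` is nonempty (a bond-shell neighbour), so `nn := infDist x (S ∖ {x}) ≥ δ > 0`
  have hnex : (S \ {x}).Nonempty := by
    obtain ⟨p, hp⟩ := Finset.card_pos.1 (by rw [hTc]; norm_num)
    obtain ⟨hpS, hpx, -⟩ := hT (Finset.mem_coe.2 hp)
    exact ⟨p, hpS, hpx⟩
  have hnd : ∀ y ∈ S, (S \ {y}).Nonempty → δ ≤ Metric.infDist y (S \ {y}) := fun y hy hne =>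
    (Metric.le_infDist hne).2 fun y₁ hy₁ => hsep y hy y₁ hy₁.1 (Ne.symm hy₁.2)
  have ha : 0 < Metric.infDist x (S \ {x}) := hδ.trans_le (hnd x hx hnex)
  -- the scale of a point `y ≠ x` is at most its distance to `x`
  have hmle : ∀ y ∈ S, y ≠ x → Metric.infDist y (S \ {y}) ≤ dist x y := fun y hy hyx => by
    rw [dist_comm]
    exact Metric.infDist_le_dist_of_mem ⟨hx, Ne.symm hyx⟩
  -- one admissible matching datum at `x`: `t = 7 nn / 40`, `r = 29 nn / 10`
  obtain ⟨s, hs, g, hCL1, hCL2⟩ := hslp (7 / 40 * Metric.infDist x (S \ {x}))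
    (29 / 10 * Metric.infDist x (S \ {x})) (by linarith) (by linarith)
  have hSO := hL1S x hx (7 / 40 * Metric.infDist x (S \ {x}))
    (29 / 10 * Metric.infDist x (S \ {x})) (by linarith) le_rfl le_rfl s g hs hCL1 hCL2
  refine ⟨fun y hy hxy => ?_, fun y hy hyx hxy => ?_, ?_, ?_⟩
  · -- (a) scale comparability
    refine scale_lower hs ha le_rfl le_rfl hCL1 hSO hy hxy ?_
    by_cases hyx : y = x
    · rw [hyx]; exact hnex
    · exact ⟨x, hx, Ne.symm hyx⟩
  · -- (b) bond symmetry: `x` is matched to a pattern point touching the label of `y`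
    obtain ⟨-, -, Ty, hTy, hTyc⟩ := hgood y hy
    have hr0 : dist x x ≤ 29 / 10 * Metric.infDist x (S \ {x}) := by rw [dist_self]; linarith
    obtain ⟨z, hz, hyz⟩ := hCL1 y hy (by linarith)
    obtain ⟨z₀, hz₀, hxz₀⟩ := hCL1 x hx hr0
    have hm := (hmle y hy hyx).trans hxy
    have hne : z ≠ z₀ := by
      intro heq
      rw [heq] at hyz
      exact hyx (hSO z₀ hz₀ (by linarith) y hy x hx hyz hxz₀)
    have hzz₀ : dist z z₀ = Metric.infDist x (S \ {x}) :=
      labels_touch hs ha le_rfl hz hz₀ hne hyz hxz₀ (by rw [dist_comm]; linarith)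
    have := dist_le_of_labels_touch hs ha le_rfl le_rfl hCL1 hSO hy hxy hz hyz hm hTy hTyc hx hz₀
      hzz₀ (by linarith) hxz₀
    rwa [dist_comm] at this
  · -- (c) exactly twelve bonded neighbours
    exact le_antisymm (ncard_bonded_le hs ha le_rfl le_rfl hCL1 hSO hx)
      (twelve_le_ncard_bonded hδ hsep x _ hT hTc)
  · -- (d) exact links, for arbitrary admissible matching data at `x`
    intro t r ht1 ht2 hr s' g' hs' hCL1' hCL2' y hy y' hy' hyx hxy hy'x hxy' hyy' z hz z' hz' hyz
      hy'z'
    have hSO' := hL1S x hx t r ht1 ht2 hr s' g' hs' hCL1' hCL2'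
    have hm := (hmle y hy hyx).trans hxy
    have ht0 : 0 ≤ t := by linarith
    constructor
    · intro hd
      refine labels_touch hs' ha ht2 hz hz' ?_ hyz hy'z' (by nlinarith)
      intro heq
      rw [← heq] at hy'z'
      refine hyy' (hSO' z hz ?_ y hy y' hy' hyz hy'z')
      have := dist_triangle x y (g' z); linarith
    · intro hzz'
      obtain ⟨-, -, Ty, hTy, hTyc⟩ := hgood y hy
      refine dist_le_of_labels_touch hs' ha ht2 hr hCL1' hSO' hy hxy hz hyz hm hTy hTyc hy' hz'
        hzz' ?_ hy'z'
      have := dist_triangle x y' (g' z'); linarith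

end Summit.AtomisticToContinuum.Crystallization.Theorems.PricedHcpWindowsLocalBarlowStructure

end
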